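import Summits.KontsevichZagierPeriods.KontsevichZagierPeriods.Theorems.SoloBlindModulusCatalan
import Summits.KontsevichZagierPeriods.KontsevichZagierPeriods.Theorems.SoloBlindLineMoves
import Literature.NumberTheory.Transcendental.KZDominatedFamilyRelations
import HarnessLib

/-!
# Integrating the Legendre family over its modulus inside the rules, IV: `∫₀¹ 2k K(k) dk = 2`

The first moment of `K` is RATIONAL: `∫₀¹ k K(k) dk = 1` (Byrd–Friedman 615.02).  The period
conjecture predicts that every representation of a rational number is equivalent to the trivial one;
we verify it for `kKBox = [(0,1)², 2k dk dt/√((1-t²)(1-k²t²))]` in FIVE moves: rule (2) along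
`(x, k) ↦ (k, 2x/(1+x²))` (tan-half-angle in `t`, coordinates swapped so that `k` becomes the fibre
variable) gives `[(0,1)², 4k/√((1+x²)² - 4k²x²)]` (`momBox`); a null modification to the band
`(0,1) × [0,1]`; rule (3) in `k` with the SEMIALGEBRAIC primitive `-√((1+x²)² - 4k²x²)/x²`, whose
boundary values `-(1-x²)/x²` (`k = 1`) and `-(1+x²)/x²` (`k = 0`) differ by the constant `2`
(`momBand_sub_twoOpen`); a null modification `(0,1) ↔ [0,1]`; rule (3): `[[0,1], 2] - [pt, 2]`.
Hence `[kKBox] = [pt, 2]` in `Q` (`mkQ_kKBox`), `∫₀¹∫₀¹ 2k dt dk/√((1-t²)(1-k²t²)) = 2` and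
`∫₀¹ k (∫₀¹ dt/√((1-t²)(1-k²t²))) dk = 1` (`integral_integral_two_mul_ellKf`,
`integral_mul_integral_ellKf`), and the Kontsevich–Zagier conjecture holds for the pair (graph body
of `2k/√((1-t²)(1-k²t²))` over `(0,1)²`, `[pt, 2]`) of `ℚ`-rational representations of the rational
period `2` (`kz_modulus_moment`).  Doing the chart first makes every primitive rational in
`x, k, √((1+x²)² - 4k²x²)`.

References: P. F. Byrd, M. D. Friedman, *Handbook of elliptic integrals* (1971), 615.02;
M. Kontsevich, D. Zagier, *Periods* (2001), §1.2.
-/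
noncomputable section

namespace Summit.KontsevichZagierPeriods.KontsevichZagierPeriods.Theorems

open Set MeasureTheory
open Literature.ModelTheory.ExponentialFields (IsSemialgebraic isSemialgebraic_setOf_eval_pos
  isSemialgebraic_setOf_eval_lt isSemialgebraic_setOf_eval_nonneg isSemialgebraic_setOf_eval_le
  tarski_seidenberg_real_holds)
open MvPolynomial (aeval X C)
open Literature.NumberTheory.Transcendental
open Literature.NumberTheory.Transcendental.KZ

namespace SoloBlind

/-! ## The chart `(x, k) ↦ (k, S(x))` -/

/-- `Ψ(x, k) = (k, 2x/(1+x²))` (source coordinates `p 0 = x`, `p 1 = k`; target `q 0 = k`,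
`q 1 = t`). -/
def mtChart (p : Fin 2 → ℝ) : Fin 2 → ℝ := ![p 1, tS (p 0)]

/-- `DΨ(p)`. -/
def mtDeriv (p : Fin 2 → ℝ) : (Fin 2 → ℝ) →L[ℝ] (Fin 2 → ℝ) :=
  ContinuousLinearMap.pi ![pr2 1, (tC (p 0) * tW (p 0)) • pr2 0]

/-- `Ψ` has derivative `DΨ`. -/
theorem hasFDerivAt_mtChart (p : Fin 2 → ℝ) : HasFDerivAt mtChart (mtDeriv p) p := by
  have hπ0 : HasFDerivAt (fun q : Fin 2 → ℝ => q 0) (pr2 0) p := hasFDerivAt_apply 0 p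
  have hπ1 : HasFDerivAt (fun q : Fin 2 → ℝ => q 1) (pr2 1) p := hasFDerivAt_apply 1 p
  rw [hasFDerivAt_pi']
  refine Fin.forall_fin_two.mpr ⟨?_, ?_⟩
  · have hfun : (fun q : Fin 2 → ℝ => mtChart q 0) = fun q => q 1 := by
      funext q; simp [mtChart]
    rw [hfun]
    refine hπ1.congr_fderiv (ContinuousLinearMap.ext fun v => ?_)
    simp [mtDeriv]
  · have hfun : (fun q : Fin 2 → ℝ => mtChart q 1) = fun q => tS (q 0) := by
      funext q; simp [mtChart]
    rw [hfun]
    refine ((hasDerivAt_tS (p 0)).comp_hasFDerivAt p hπ0).congr_fderiv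
      (ContinuousLinearMap.ext fun v => ?_)
    simp [mtDeriv]

/-- The matrix of `DΨ(p)`. -/
theorem toMatrix_mtDeriv (p : Fin 2 → ℝ) :
    LinearMap.toMatrix' ((mtDeriv p : (Fin 2 → ℝ) →L[ℝ] (Fin 2 → ℝ)) :
      (Fin 2 → ℝ) →ₗ[ℝ] (Fin 2 → ℝ)) = !![0, 1; tC (p 0) * tW (p 0), 0] := by
  ext i j
  rw [LinearMap.toMatrix'_apply, ContinuousLinearMap.coe_coe]
  fin_cases i <;> fin_cases j <;> simp [mtDeriv]

/-- `|det DΨ(p)| = C(x)W(x)` on the square. -/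
theorem abs_det_mtDeriv {p : Fin 2 → ℝ} (hp : p ∈ kzOpenBox 2) :
    |(mtDeriv p).det| = tC (p 0) * tW (p 0) := by
  obtain ⟨⟨hx0, hx1⟩, -, -, -⟩ := mem_kzOpenBox_two hp
  rw [ContinuousLinearMap.det, ← LinearMap.det_toMatrix', toMatrix_mtDeriv, Matrix.det_fin_two_of]
  simp only [mul_zero, zero_sub, abs_neg, one_mul]
  exact abs_of_pos (mul_pos (tC_pos hx0.le hx1) (tW_pos _))

/-- `Ψ` maps the square into itself. -/
theorem mtChart_mem {p : Fin 2 → ℝ} (hp : p ∈ kzOpenBox 2) : mtChart p ∈ kzOpenBox 2 := by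
  obtain ⟨⟨hx0, hx1⟩, ⟨hk0, hk1⟩, -, -⟩ := mem_kzOpenBox_two hp
  intro i
  fin_cases i
  · exact ⟨hk0, hk1⟩
  · show tS (p 0) ∈ Ioo 0 1
    refine ⟨tS_pos hx0, ?_⟩
    rw [tS, div_lt_one (by positivity)]
    nlinarith [mul_pos (sub_pos.2 hx1) (sub_pos.2 hx1)]

/-- `Ψ` is injective on the square. -/
theorem injOn_mtChart : InjOn mtChart (kzOpenBox 2) := by
  intro p hp p' hp' h
  obtain ⟨⟨hx0, hx1⟩, -, -, -⟩ := mem_kzOpenBox_two hp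
  obtain ⟨⟨hx0', hx1'⟩, -, -, -⟩ := mem_kzOpenBox_two hp'
  have h0 := congrFun h 0
  have h1 := congrFun h 1
  simp only [mtChart, Matrix.cons_val_zero, Matrix.cons_val_one, tS] at h0 h1
  have ex : p 0 = p' 0 := by
    rw [div_eq_div_iff (by positivity) (by positivity)] at h1
    have h2 : (p 0 - p' 0) * (1 - p 0 * p' 0) = 0 := by linear_combination h1 / 2
    rcases mul_eq_zero.1 h2 with h3 | h3
    · linarith
    · nlinarith [mul_pos hx0 hx0']
  funext i
  fin_cases i
  · exact ex
  · exact h0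

/-- `Ψ((0,1)²) = (0,1)²`. -/
theorem image_mtChart : mtChart '' kzOpenBox 2 = kzOpenBox 2 := by
  refine Subset.antisymm (image_subset_iff.2 fun p hp => mtChart_mem hp) fun q hq => ?_
  obtain ⟨⟨hk0, hk1⟩, ⟨ht0, ht1⟩, -, -⟩ := mem_kzOpenBox_two hq
  have hSc : ContinuousOn tS (Icc 0 1) := fun u _ =>
    (hasDerivAt_tS u).continuousAt.continuousWithinAt
  obtain ⟨x, hx, hxq⟩ : ∃ x ∈ Ioo (0 : ℝ) 1, tS x = q 1 := by
    have h := intermediate_value_Ioo (zero_le_one : (0 : ℝ) ≤ 1) hSc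
    rw [show tS 0 = 0 by simp [tS], show tS 1 = 1 by norm_num [tS]] at h
    exact h ⟨ht0, ht1⟩
  refine ⟨![x, q 0],
    Fin.forall_fin_two.2 ⟨by simpa using hx, by simpa using (⟨hk0, hk1⟩ : q 0 ∈ Ioo 0 1)⟩, ?_⟩
  funext i
  fin_cases i <;> simp [mtChart, hxq]

/-- `Ψ` is a `ℚ`-semialgebraic map on the square. -/
theorem isSemialgebraicMapOn_mtChart : IsSemialgebraicMapOn ℚ (kzOpenBox 2) mtChart := by
  have hS := isSemialgebraic_kzOpenBox 2
  refine IsSemialgebraicMapOn.of_forall hS fun i => ?_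
  fin_cases i
  · exact (isSemialgebraicFunOn_aeval hS (X 1)).congr fun p _ => by simp [mtChart]
  · exact (isSemialgebraicFunOn_aeval_div_aeval hS (2 * X 0) (1 + X 0 ^ 2)
      fun p _ => by
        have : (0 : ℝ) < 1 + p 0 ^ 2 := by positivity
        simpa using this.ne').congr fun p _ => by simp [mtChart, tS]

/-! ## The representations -/

/-- **`[(0,1)², 2k dk dt/√((1-t²)(1-k²t²))]`** ("`∫₀¹ 2k K(k) dk`"; `q 0 = k`, `q 1 = t`). -/
def kKBox : IntegralRep 2 where
  domain := kzOpenBox 2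
  integrand q := 2 * q 0 * ellKf (q 0 ^ 2) (q 1)
  isSemialgebraic_domain := isSemialgebraic_kzOpenBox 2
  isSemialgebraicFunOn_integrand :=
    ((isSemialgebraicFunOn_aeval (isSemialgebraic_kzOpenBox 2) (2 * X 0)).fun_mul
      isSemialgebraicFunOn_ellKf_box).congr fun q _ => by simp
  integrableOn := by
    refine legKBox.integrableOn.bdd_mul (c := 2) (by fun_prop : Continuous fun q : Fin 2 → ℝ =>
      2 * q 0).aestronglyMeasurable ((ae_restrict_iff' (measurableSet_kzOpenBox 2)).2
        (ae_of_all _ fun q hq => ?_))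
    have h := hq 0
    rw [Real.norm_eq_abs, abs_of_pos (by linarith [h.1])]
    linarith [h.2]

/-- The moment form `4k/√((1+x²)² - 4k²x²)` (`p 0 = x`, `p 1 = k`). -/
def momF (p : Fin 2 → ℝ) : ℝ := 4 * p 1 / Real.sqrt ((1 + p 0 ^ 2) ^ 2 - 4 * p 1 ^ 2 * p 0 ^ 2)

/-- The half-closed band `(0,1) × [0,1]`. -/
def momBand : Set (Fin 2 → ℝ) := {z | (0 < z 0 ∧ z 0 < 1) ∧ 0 ≤ z 1 ∧ z 1 ≤ 1}

/-- The band is `ℚ`-semialgebraic. -/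
theorem isSemialgebraic_momBand : IsSemialgebraic ℚ momBand := by
  have h0 := isSemialgebraic_setOf_eval_pos (R := ℝ) (X 0 : MvPolynomial (Fin 2) ℚ)
  have h1 := isSemialgebraic_setOf_eval_lt (R := ℝ) (X 0 : MvPolynomial (Fin 2) ℚ) 1
  have h2 := isSemialgebraic_setOf_eval_nonneg (R := ℝ) (X 1 : MvPolynomial (Fin 2) ℚ)
  have h3 := isSemialgebraic_setOf_eval_le (R := ℝ) (X 1 : MvPolynomial (Fin 2) ℚ) 1
  convert (h0.inter h1).inter (h2.inter h3) using 1
  all_goals first | rfl | (ext z; simp [momBand])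

/-- `(0,1)² ⊆ (0,1) × [0,1]`. -/
theorem kzOpenBox_subset_momBand : kzOpenBox 2 ⊆ momBand := fun _ hz =>
  ⟨⟨(hz 0).1, (hz 0).2⟩, (hz 1).1.le, (hz 1).2.le⟩

/-- The band and the open square differ by a null set. -/
theorem volume_momBand_diff : volume (momBand \ kzOpenBox 2) = 0 := by
  have hp : ∀ a : ℝ, volume {z : Fin 2 → ℝ | z 1 = a} = 0 := fun a => by
    rw [MeasureTheory.volume_pi]; exact Measure.pi_hyperplane (fun _ => (volume : Measure ℝ)) 1 a
  refine measure_mono_null (fun z ⟨hB, hO⟩ => ?_) (measure_union_null (hp 0) (hp 1))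
  by_contra h
  simp only [mem_union, mem_setOf_eq, not_or] at h
  refine hO fun i => ?_
  fin_cases i
  · exact hB.1
  · exact ⟨lt_of_le_of_ne hB.2.1 (Ne.symm h.1), lt_of_le_of_ne hB.2.2 h.2⟩

/-- **The chart identity**: `4k/√((1+x²)²-4k²x²) = 2k/√((1-S²)(1-k²S²)) · C(x)W(x)`, `S = S(x)`. -/
theorem momF_eq {p : Fin 2 → ℝ} (hp : p ∈ kzOpenBox 2) :
    momF p = 2 * p 1 * ellKf (p 1 ^ 2) (tS (p 0)) * (tC (p 0) * tW (p 0)) := by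
  obtain ⟨⟨hx0, hx1⟩, ⟨hk0, hk1⟩, -, -⟩ := mem_kzOpenBox_two hp
  have hC : 0 < tC (p 0) := tC_pos hx0.le hx1
  have hD : (0 : ℝ) < 1 + p 0 ^ 2 := by positivity
  have hrad : (1 + p 0 ^ 2) ^ 2 - 4 * p 1 ^ 2 * p 0 ^ 2 =
      (1 + p 0 ^ 2) ^ 2 * (1 - p 1 ^ 2 * tS (p 0) ^ 2) := by
    unfold tS; field_simp; ring
  have ht : tS (p 0) ∈ Ioo 0 1 := by simpa [mtChart] using mtChart_mem hp 1
  have hin : 0 < 1 - p 1 ^ 2 * tS (p 0) ^ 2 := by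
    have h2 : tS (p 0) ^ 2 ≤ 1 := pow_le_one₀ ht.1.le ht.2.le
    nlinarith [mul_nonneg (sq_nonneg (p 1)) (sub_nonneg.2 h2), pow_lt_one₀ hk0.le hk1 two_ne_zero]
  have hS : 0 < Real.sqrt (1 - p 1 ^ 2 * tS (p 0) ^ 2) := Real.sqrt_pos.2 hin
  rw [momF, ellKf, one_sub_tS_sq, hrad, Real.sqrt_mul (by positivity), Real.sqrt_sq hD.le,
    Real.sqrt_mul (by positivity), Real.sqrt_sq hC.le]
  unfold tW
  field_simp
  ring

/-- `momF` is absolutely integrable on the open square (transported from `kKBox` along `Ψ`). -/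
theorem integrableOn_momF : IntegrableOn momF (kzOpenBox 2) := by
  have h := (integrableOn_iff_of_chart (f := momF)
    (g := fun q => 2 * q 0 * ellKf (q 0 ^ 2) (q 1)) (J := fun p => tC (p 0) * tW (p 0))
    (measurableSet_kzOpenBox 2) (fun p _ => hasFDerivAt_mtChart p) injOn_mtChart
    (fun _ hp => abs_det_mtDeriv hp) (fun p hp => by simpa [mtChart] using momF_eq hp)).mp
  rw [image_mtChart] at h
  exact h kKBox.integrableOn

/-- **`[(0,1) × [0,1], 4k/√((1+x²)² - 4k²x²)]`** (the band form). -/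
def momBand' : IntegralRep 2 where
  domain := momBand
  integrand := momF
  isSemialgebraic_domain := isSemialgebraic_momBand
  isSemialgebraicFunOn_integrand :=
    ((isSemialgebraicFunOn_aeval isSemialgebraic_momBand (4 * X 1)).fun_mul
      (isSemialgebraicFunOn_aeval isSemialgebraic_momBand
        ((1 + X 0 ^ 2) ^ 2 - 4 * X 1 ^ 2 * X 0 ^ 2)).fun_sqrt.fun_inv).congr
      fun p _ => by simp [momF, div_eq_mul_inv]
  integrableOn := integrableOn_momF.congr_set_ae
    (ae_eq_set.2 ⟨volume_momBand_diff,
      measure_mono_null (fun z hz => hz.2 (kzOpenBox_subset_momBand hz.1)) measure_empty⟩)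

/-- **`[(0,1)², 4k/√((1+x²)² - 4k²x²)]`**, the restriction of the band form to the open square. -/
def momBox : IntegralRep 2 :=
  momBand'.restrict (kzOpenBox 2) (isSemialgebraic_kzOpenBox 2) kzOpenBox_subset_momBand

/-- The `k`-primitive `-√((1+x²)² - 4k²x²)/x²` of the moment form. -/
def momPrim (z : Fin 2 → ℝ) : ℝ := -Real.sqrt ((1 + z 0 ^ 2) ^ 2 - 4 * z 1 ^ 2 * z 0 ^ 2) / z 0 ^ 2

/-- **`[[0,1], 2]`.** -/
def twoClosed : IntegralRep 1 :=
  lineRep (Icc 0 1) (fun _ => 2) (isSemialgebraic_line_Icc isAlgebraic_zero isAlgebraic_one)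
    ((isSemialgebraicFunOn_aeval (isSemialgebraic_line_Icc isAlgebraic_zero isAlgebraic_one)
      (2 : MvPolynomial (Fin 1) ℚ)).congr fun x _ => by simp)
    (continuous_const.integrableOn_Icc)

/-- **`[(0,1), 2]`**, the restriction of `twoClosed`. -/
def twoOpen : IntegralRep 1 :=
  twoClosed.restrict (line (Ioo 0 1)) (isSemialgebraic_line_Ioo isAlgebraic_zero isAlgebraic_one)
    fun _ hx => ⟨le_of_lt (mem_line.1 hx).1, le_of_lt (mem_line.1 hx).2⟩

/-- **The point cell `[pt, 2]`.** -/
def twoCell : IntegralRep 0 :=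
  constCell 2 (by
    have h := isAlgebraic_algebraMap (R := ℚ) (A := ℝ) (2 : ℚ)
    rwa [map_ofNat] at h)

/-- `[pt, 2]` has KZ's literal rational shape. -/
theorem isRational_twoCell : twoCell.IsRational :=
  ⟨2, 1, fun _ _ => by simp, fun _ _ => by simp [twoCell, constCell_integrand]⟩

/-- **Rule (2) along `Ψ`**: `[(0,1)², 4k/√((1+x²)²-4k²x²)] ≡ [(0,1)², 2k/√((1-t²)(1-k²t²))]`. -/
theorem momBox_equiv_kKBox : Equivalent momBox kKBox :=
  equivalent_of_chart (f := momF) (g := fun q => 2 * q 0 * ellKf (q 0 ^ 2) (q 1))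
    (J := fun p => tC (p 0) * tW (p 0)) isSemialgebraicMapOn_mtChart
    (fun p _ => hasFDerivAt_mtChart p) injOn_mtChart image_mtChart
    (fun _ hp => abs_det_mtDeriv hp) (fun p hp => by simpa [mtChart] using momF_eq hp)
    rfl (fun _ _ => rfl) rfl (fun _ _ => rfl)

/-- **Null modification**: `[(0,1) × [0,1], ·] - [(0,1)², ·]` is a relation. -/
theorem momBand_sub_momBox : of momBand' - of momBox ∈ relations :=
  momBand'.of_sub_of_restrict_mem_relations (isSemialgebraic_kzOpenBox 2)
    kzOpenBox_subset_momBand volume_momBand_diff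

/-- **Rule (3) in `k`**: `[(0,1) × [0,1], ∂ₖP] - [(0,1), P(·,1) - P(·,0)] = … - [(0,1), 2]` is a
relation. -/
theorem momBand_sub_twoOpen : of momBand' - of twoOpen ∈ relations := by
  have e0 : ∀ (x : Fin 1 → ℝ) (t : ℝ), (Fin.snoc x t : Fin 2 → ℝ) 0 = x 0 := fun _ _ => rfl
  have e1 : ∀ (x : Fin 1 → ℝ) (t : ℝ), (Fin.snoc x t : Fin 2 → ℝ) 1 = t := fun _ _ => rfl
  have hdom : ∀ x ∈ twoOpen.domain, 0 < x 0 ∧ x 0 < 1 := fun x hx => by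
    simpa [twoOpen, twoClosed, IntegralRep.restrict, mem_line] using hx
  refine newtonLeibnizRel_subset_relations ⟨1, momBand', twoOpen, fun _ => 0, fun _ => 1,
    momPrim, ?_,
    isSemialgebraicFunOn_const_of_isAlgebraic twoOpen.isSemialgebraic_domain isAlgebraic_zero,
    isSemialgebraicFunOn_const_of_isAlgebraic twoOpen.isSemialgebraic_domain isAlgebraic_one,
    fun _ _ => zero_le_one, ?_, ?_, ?_, ?_, rfl⟩
  · exact ((isSemialgebraicFunOn_aeval isSemialgebraic_momBand
      ((1 + X 0 ^ 2) ^ 2 - 4 * X 1 ^ 2 * X 0 ^ 2)).fun_sqrt.fun_mul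
      (isSemialgebraicFunOn_aeval_div_aeval isSemialgebraic_momBand (-1) (X 0 ^ 2)
        fun z hz => by simpa using (pow_pos hz.1.1 2).ne')).congr fun z _ => by
          simp [momPrim, div_eq_mul_inv]
  · ext z
    simp only [momBand', momBand, mem_setOf_eq, twoOpen, twoClosed, IntegralRep.restrict,
      mem_line, mem_Ioo, Fin.init, Fin.castSucc_zero, show (Fin.last 1 : Fin 2) = 1 from rfl]
  · intro x hx
    simp only [e0, e1, momPrim]
    exact ((Real.continuous_sqrt.comp (by fun_prop)).neg.div_const _).continuousOn
  · intro x hx k hk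
    have hx' := hdom x hx
    have hrad : 0 < (1 + x 0 ^ 2) ^ 2 - 4 * k ^ 2 * x 0 ^ 2 := by
      have hk1 : k ^ 2 < 1 := pow_lt_one₀ hk.1.le hk.2 two_ne_zero
      nlinarith [mul_pos (sub_pos.2 hx'.2) (sub_pos.2 hx'.2), mul_pos hx'.1 hx'.1,
        mul_nonneg (sub_nonneg.2 hk1.le) (sq_nonneg (x 0))]
    have hs : Real.sqrt ((1 + x 0 ^ 2) ^ 2 - 4 * k ^ 2 * x 0 ^ 2) ≠ 0 :=
      (Real.sqrt_pos.2 hrad).ne'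
    have hx0 : x 0 ≠ 0 := hx'.1.ne'
    have hu := (((hasDerivAt_pow 2 k).const_mul 4).mul_const (x 0 ^ 2)).const_sub
      ((1 + x 0 ^ 2) ^ 2)
    have hd := ((hu.sqrt hrad.ne').neg).div_const (x 0 ^ 2)
    simp only [e0, e1, momBand', momPrim, momF]
    refine hd.congr_deriv ?_
    simp only [Nat.cast_ofNat]
    field_simp
    ring
  · intro x hx
    have hx0 : x 0 ≠ 0 := (hdom x hx).1.ne'
    have hx1 : (0 : ℝ) ≤ 1 - x 0 ^ 2 := by nlinarith [(hdom x hx).2, (hdom x hx).1]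
    have h1 : momPrim (Fin.snoc x 1) = -(1 - x 0 ^ 2) / x 0 ^ 2 := by
      rw [momPrim, e0, e1, show (1 + x 0 ^ 2) ^ 2 - 4 * (1 : ℝ) ^ 2 * x 0 ^ 2 = (1 - x 0 ^ 2) ^ 2 by
        ring, Real.sqrt_sq hx1]
    have h0 : momPrim (Fin.snoc x 0) = -(1 + x 0 ^ 2) / x 0 ^ 2 := by
      rw [momPrim, e0, e1, show (1 + x 0 ^ 2) ^ 2 - 4 * (0 : ℝ) ^ 2 * x 0 ^ 2 = (1 + x 0 ^ 2) ^ 2 by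
        ring, Real.sqrt_sq (by positivity)]
    show (2 : ℝ) = momPrim (Fin.snoc x 1) - momPrim (Fin.snoc x 0)
    rw [h1, h0]
    field_simp
    ring

/-- **Null modification**: `[[0,1], 2] - [(0,1), 2]` is a relation. -/
theorem twoClosed_sub_twoOpen : of twoClosed - of twoOpen ∈ relations := by
  refine twoClosed.of_sub_of_restrict_mem_relations
    (isSemialgebraic_line_Ioo isAlgebraic_zero isAlgebraic_one) _ ?_
  have hp : ∀ a : ℝ, volume {z : Fin 1 → ℝ | z 0 = a} = 0 := fun a => by
    rw [MeasureTheory.volume_pi]; exact Measure.pi_hyperplane (fun _ => (volume : Measure ℝ)) 0 a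
  refine measure_mono_null (fun z ⟨hC, hO⟩ => ?_) (measure_union_null (hp 0) (hp 1))
  simp only [twoClosed, lineRep_domain, mem_line, mem_Icc, mem_Ioo, not_and_or, not_lt] at hC hO
  simp only [mem_union, mem_setOf_eq]
  rcases hO with h | h
  · exact Or.inl (le_antisymm h hC.1)
  · exact Or.inr (le_antisymm hC.2 h)

/-- **Rule (3) on the segment**: `[[0,1], 2] - [pt, 2]` is a relation (primitive `2y`). -/
theorem twoClosed_sub_twoCell : of twoClosed - of twoCell ∈ relations := by
  have h2 : IsAlgebraic ℚ ((2 : ℝ)) := by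
    have h := isAlgebraic_algebraMap (R := ℚ) (A := ℝ) (2 : ℚ)
    rwa [map_ofNat] at h
  have hnum : (2 : ℝ) * 1 - 2 * 0 = 2 := by norm_num
  have hα : IsAlgebraic ℚ ((2 : ℝ) * 1 - 2 * 0) := by rwa [← hnum] at h2
  have h : of twoClosed - of (constCell ((2 : ℝ) * 1 - 2 * 0) hα) ∈ relations :=
    lineRep_newtonLeibniz isAlgebraic_zero isAlgebraic_one zero_le_one
      (f := fun _ => 2) (fun s : ℝ => 2 * s)
      ((isSemialgebraicFunOn_aeval (isSemialgebraic_line_Icc isAlgebraic_zero isAlgebraic_one)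
        (2 * X 0)).congr fun x _ => by simp)
      (by fun_prop : Continuous fun s : ℝ => 2 * s).continuousOn
      (fun t _ => ((hasDerivAt_id' t).const_mul 2).congr_deriv (mul_one 2))
  rwa [constCell_congr hnum (hβ := h2)] at h

/-- **`[(0,1)², 2k dk dt/√((1-t²)(1-k²t²))] = [pt, 2]` in `Q`.** -/
theorem mkQ_kKBox : mkQ (of kKBox) = mkQ (of twoCell) := by
  rw [← mkQ_eq_mkQ_iff.2 momBox_equiv_kKBox, ← mkQ_eq_mkQ_iff.2 momBand_sub_momBox,
    mkQ_eq_mkQ_iff.2 momBand_sub_twoOpen, ← mkQ_eq_mkQ_iff.2 twoClosed_sub_twoOpen]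
  exact mkQ_eq_mkQ_iff.2 twoClosed_sub_twoCell

/-- **`∫_{(0,1)²} 2k/√((1-t²)(1-k²t²)) = 2`.** -/
theorem kKBox_value : kKBox.value = 2 := by
  have h := congrArg evalQ mkQ_kKBox
  rwa [evalQ_mkQ, evalQ_mkQ, eval_of, eval_of, twoCell, value_constCell] at h

/-- **`∫₀¹ 2k K(k) dk = 2`** as an iterated integral. -/
theorem integral_integral_two_mul_ellKf :
    ∫ k in Ioo (0 : ℝ) 1, ∫ t in Ioo (0 : ℝ) 1, 2 * k * ellKf (k ^ 2) t = 2 := by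
  rw [← setIntegral_kzOpenBox_two (fun k t => 2 * k * ellKf (k ^ 2) t) kKBox.integrableOn]
  exact kKBox_value

/-- **`∫₀¹ k K(k) dk = 1`**: `∫₀¹ k (∫₀¹ dt/√((1-t²)(1-k²t²))) dk = 1`. -/
theorem integral_mul_integral_ellKf :
    ∫ k in Ioo (0 : ℝ) 1, k * ∫ t in Ioo (0 : ℝ) 1, ellKf (k ^ 2) t = 1 := by
  have h := integral_integral_two_mul_ellKf
  simp_rw [mul_assoc, integral_const_mul] at h
  linarith

/-- **Kontsevich–Zagier for the rational period `∫₀¹ 2k K(k) dk = 2`.** The volume under the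
graph of `2k/√((1-t²)(1-k²t²))` over `(0,1)²` and the point cell `[pt, 2]` are `ℚ`-rational
representations of `2` and are KZ-equivalent — as the conjecture predicts for rational numbers. -/
theorem kz_modulus_moment :
    (kKBox.graphRep tarski_seidenberg_real_holds).IsRational ∧ twoCell.IsRational ∧
      (kKBox.graphRep tarski_seidenberg_real_holds).value = twoCell.value ∧
      Equivalent (kKBox.graphRep tarski_seidenberg_real_holds) twoCell :=
  ⟨IntegralRep.isRational_graphRep _ _, isRational_twoCell,
    by rw [← Equivalent.value_eq_holds (kKBox.equivalent_graphRep _), kKBox_value, twoCell,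
      value_constCell],
    (kKBox.equivalent_graphRep _).symm.trans (mkQ_eq_mkQ_iff.1 mkQ_kKBox)⟩

end SoloBlind

end Summit.KontsevichZagierPeriods.KontsevichZagierPeriods.Theorems
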